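import Summits.Ventures.YMGap.FlowData.RectTubeMagneticTwistOneSite
import Summits.Ventures.YMGap.FlowData.RectTubeOneSitePlaquetteHaar
import HarnessLib

/-!
# Venture YMGap, track Y3 FLOW-DATA — the ONE-SITE LAW of the magnetic-flux rows: `E_mag(β; 1^k; S) = (β/2)·#S + O(β²)`
# with an explicit constant (theorems only)

HONEST FRAMING: venture file of the cell `pub-ymgap` (QuantumFields programme), track Y3 (FLOW-DATA); the corollary of
`RectTubeMagneticTwistOneSite.lean` (`|E_mag − β h_S| ≤ 2β#S(e^{4β(3#P+N)} − 1)`) and `RectTubeOneSitePlaquetteHaar.lean` (`h_S = #S/2`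
on one-site tori) for the FLOW-TABLE's magnetic-flux rows (all on the one-site tori `1²` (d=3) and `1³` (d=4), one twisted
plaquette): **`abs_su2RectMagneticFluxEnergy_oneSite_sub_le`** —
`|E_mag(β; 1^k; S) − (β/2)·#S| ≤ 2β·#S·(e^{4β(3·k(k−1)/2 + k)} − 1)` for `β ≥ 0`.  The leading coefficient `½` per twisted plaquette is
IDENTIFIED (a theorem), the remainder is `O(β²)` with a constant that is useless at the table's `β ≥ ¼`: an asymptotic statement, not
a window for the tabled cells.  Finite objects; nothing about `L → ∞`, the continuum or a mass gap.

References: G. 't Hooft, Nucl. Phys. B 153 (1979) 141 [cite: tHooft1979Flux]; I. Montvay, G. Münster (1994) §3.2.6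
[cite: MontvayMunster1994, §3.2.6].
-/

noncomputable section

open scoped BigOperators ENNReal
open MeasureTheory Filter Function
open Literature.MathematicalPhysics.QuantumFieldTheory Literature.Analysis.OperatorTheory
open Literature.MathematicalPhysics.QuantumLattice (RectTorusSite fundamentalRep continuous_fundamentalRep)
open Summit.Ventures.YMGap.Census (RectPlaquette rectPlaquetteHolonomy)

namespace Summit.Ventures.YMGap.FlowData

variable {k : ℕ}

/-- On the one-site torus every unit vector `eᵢ` of `Π ℤ/1` vanishes. [folklore] -/
theorem rectTorusSite_oneSite_single_eq_zero (i : Fin k) : (Pi.single i 1 : RectTorusSite (fun _ : Fin k => 1)) = 0 :=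
  Subsingleton.elim _ _

/-- **The Haar value of the twisted-plaquette load on the one-site torus: `h_S = #S/2`.** [cite: MontvayMunster1994, §3.2.6] -/
theorem su2_integral_plaquetteLoad_oneSite (S : Finset (RectPlaquette (fun _ : Fin k => 1))) :
    ∫ a, (∑ q ∈ S, (fundamentalRep (Fin 2) (rectPlaquetteHolonomy a q.1 q.2.1.1 q.2.1.2)).trace.re)
        ∂(rectSliceMeasure (Matrix.specialUnitaryGroup (Fin 2) ℂ) (fun _ : Fin k => 1)) = S.card / 2 := by
  haveI : SecondCountableTopology (Matrix.specialUnitaryGroup (Fin 2) ℂ) :=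
    Literature.MathematicalPhysics.QuantumLattice.secondCountableTopology_su2
  rw [integral_finsetSum]
  · have hq : ∀ q ∈ S, ∫ a, ((fundamentalRep (Fin 2) (rectPlaquetteHolonomy a q.1 q.2.1.1 q.2.1.2)).trace).re
        ∂(rectSliceMeasure (Matrix.specialUnitaryGroup (Fin 2) ℂ) (fun _ : Fin k => 1)) = 1 / 2 := fun q _ =>
      su2_integral_re_trace_rectPlaquetteHolonomy_oneSite q.1 (ne_of_lt q.2.2)
        (rectTorusSite_oneSite_single_eq_zero _) (rectTorusSite_oneSite_single_eq_zero _)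
    rw [Finset.sum_congr rfl hq, Finset.sum_const, nsmul_eq_mul]
    ring
  · intro q _
    exact ((Complex.continuous_re.comp (Continuous.matrix_trace (continuous_fundamentalRep (Fin 2)))).comp
      (continuous_rectPlaquetteHolonomy q.1 q.2.1.1 q.2.1.2)).integrable_of_hasCompactSupport (HasCompactSupport.of_compactSpace _)

/-- ★ **THE ONE-SITE LAW: `|E_mag(β; 1^k; S) − (β/2)·#S| ≤ 2β·#S·(e^{4β(3#P+N)} − 1)`** (`#P = k(k−1)/2` plaquettes, `N = k` links on the
one-site torus), `β ≥ 0`: the magnetic-flux energy of the table's one-site rows is `(β/2)` per twisted plaquette to first order.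
Asymptotic statement. [cite: tHooft1979Flux] [cite: MontvayMunster1994, §3.2.6] -/
theorem abs_su2RectMagneticFluxEnergy_oneSite_sub_le {β : ℝ} (hβ : 0 ≤ β) (S : Finset (RectPlaquette (fun _ : Fin k => 1))) :
    |su2RectMagneticFluxEnergy β (fun _ : Fin k => 1) S - β / 2 * S.card| ≤
      β * ((2 * S.card) * (Real.exp (4 * (β * (3 * (Fintype.card (RectTorusSite (fun _ : Fin k => 1)) *
        Fintype.card {p : Fin k × Fin k // p.1 < p.2}) + Fintype.card (RectTorusSite (fun _ : Fin k => 1) × Fin k)))) - 1)) := by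
  have h := abs_su2RectMagneticFluxEnergy_sub_haar_le hβ (fun _ : Fin k => 1) S
  rw [su2_integral_plaquetteLoad_oneSite S] at h
  have h2 : β * (S.card / 2 : ℝ) = β / 2 * S.card := by ring
  rw [h2] at h
  exact h

end Summit.Ventures.YMGap.FlowData
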